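import Summits.QuantumFields.YangMills.Theses.UniversalDetector
import Summits.QuantumFields.YangMills.Theorems.UniversalDetectorLatticeInvariance
import Summits.QuantumFields.YangMills.Theorems.UniversalDetectorKernelPermutation
import Summits.QuantumFields.YangMills.Theorems.UniversalDetectorQ2NearKernel
import Summits.QuantumFields.YangMills.Theorems.UniversalDetectorTight6Sequential

/-!
# Route `UniversalDetector` — proof of the support item `PlaneLimitExtraction` (stmt-QuantumFields-23251)

Ideator seat ym-idea-8 g7 (LINE 4 of rung R2a = `BalabanLadder.NT`).  `PlaneLimitExtraction` is the purely
lattice-side extraction step of the universal-detector route: under the plane-resolved tightness (TIGHT6) of the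
unit-normalised torus two-point kernels of the curvature density along `a → 0⁺`, every admissible scheme
(`β_k → ∞`, `a(β_k) L_k → ∞`) has a subsequence along which the full kernel `a⁻⁸ Cov_T(dens 0, dens z)` converges,
locally uniformly on annuli, to a limit kernel `K` that is continuous off the origin, bounded away from it, even,
time-reflection and coordinate-permutation invariant, reflection positive on time slabs, and reproduces the limits of
the Schwartz-weighted Riemann sums `Q2`.

The proof assembles the modules landed for this item:
`tight_of_tight6` (TIGHT6 ⇒ TIGHT, the explicit form of the closed item `TightOfPlaneTight`, restated here so
that this file imports no other module of the route's theses cone) · `latticeKernel_extraction_of_tight` (mesh Arzelà–Ascoli: clauses 1–3) ·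
`latticeLimit_invariant_approx` (transport of lattice symmetries to the limit) with `cov_dens_zero_neg`,
`reflect_defect_eventually`, `cov_dens_zero_perm` (clauses 4–6) · `integral_nonneg_of_Q2_ge_neg` with
`Q2_farBound_of_tight`, `Q2_nearKernel_of_approx`, `Q2_thetaTest_eventually_ge_neg` (clause 7, slab RP) ·
`tendsto_Q2_of_near_kernel` (clause 8).

No summit, rung or crux is proved here: the route's crux `PlaneTightScheme` (TIGHT6 ∧ NONCONTACT for some scheme)
and the residual `SkewAtScheme` remain open.
-/

set_option autoImplicit false

noncomputable section

open scoped SchwartzMap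
open MeasureTheory Filter Topology
open Literature.MathematicalPhysics.QuantumFieldTheory Literature.MathematicalPhysics.QuantumLattice
  Literature.Probability.LatticeModels
open Summit.QuantumFields.YangMills.Cruxes.OSLegsFromFemtoAndGap.DlrCollarTransfer
open Summit.QuantumFields.YangMills.Cruxes.UniversalDetectorLimitExtraction (tendsto_Q2_of_near_kernel)

namespace Summit.QuantumFields.YangMills.Cruxes.UniversalDetectorPlaneTight

/-- Negation preserves the centred box. -/
private theorem neg_mem_box' {d L : ℕ} {z : Site d} (hz : z ∈ box d L) : -z ∈ box d L := by
  rw [mem_box] at hz ⊢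
  intro i
  have := hz i
  simp only [Pi.neg_apply]
  omega

/-- A coordinate permutation preserves the centred box. -/
private theorem perm_mem_box' {d L : ℕ} {z : Site d} (hz : z ∈ box d L) (σ : Equiv.Perm (Fin d)) :
    (fun i => z (σ i)) ∈ box d L := by
  rw [mem_box] at hz ⊢
  exact fun i => hz (σ i)

/-- The scaled embedding commutes with negation. -/
private theorem siteToE_neg' {d : ℕ} (s : ℝ) (z : Site d) : s • siteToE (-z) = -(s • siteToE z) := by
  rw [← smul_neg]
  congr 1
  ext i
  simp [siteToE_apply]

/-- The scaled embedding intertwines a coordinate permutation of sites with the corresponding isometry. -/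
private theorem siteToE_perm' {d : ℕ} (s : ℝ) (z : Site d) (σ : Equiv.Perm (Fin d)) :
    s • siteToE (fun i => z (σ i)) =
      LinearIsometryEquiv.piLpCongrLeft 2 ℝ ℝ σ.symm (s • siteToE z) := by
  ext i
  simp [LinearIsometryEquiv.piLpCongrLeft_apply, Equiv.piCongrLeft'_apply, siteToE_apply]

/-- The coordinate-permutation isometry, written as in the item. -/
private theorem piLpCongrLeft_symm_eq_toLp' {d : ℕ} (σ : Equiv.Perm (Fin d)) (z : EuclideanSpace ℝ (Fin d)) :
    LinearIsometryEquiv.piLpCongrLeft 2 ℝ ℝ σ.symm z = WithLp.toLp 2 (fun i => z (σ i)) := by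
  ext i
  simp [LinearIsometryEquiv.piLpCongrLeft_apply, Equiv.piCongrLeft'_apply]

/-- **TIGHT6 ⇒ TIGHT, explicit form** (the content of the closed item `TightOfPlaneTight`, module
`UniversalDetectorTightOfPlaneTight`, restated over the explicit kernels so that this file stays out of the rest of
the theses cone): the full unit-normalised kernel is the sum of the 36 plane kernels, so bounds and moduli add up. -/
theorem tight_of_tight6 {G : Type} [Group G] [TopologicalSpace G] [IsTopologicalGroup G] [CompactSpace G]
    [MeasurableSpace G] [BorelSpace G] (r : LatticeRep G) (a : ℝ → ℝ)
    (hT6 : ∀ p q : Fin 4 × Fin 4, p.1 < p.2 → q.1 < q.2 → ∀ η : ℝ, 0 < η → ∃ (C β₅ Λ₅ : ℝ) (ω : ℝ → ℝ),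
      Tendsto ω (𝓝[>] 0) (𝓝 0) ∧ ∀ β : ℝ, β₅ ≤ β → ∀ L : ℕ, Λ₅ ≤ a β * L → ∀ z ∈ box 4 L,
        η ≤ ‖a β • siteToE z‖ →
          |(a β)⁻¹ ^ 8 * (torusE G r β L (fun U => plane G r p 0 U * plane G r q z U) -
              torusE G r β L (plane G r p 0) * torusE G r β L (plane G r q z))| ≤ C ∧
            ∀ z' ∈ box 4 L, η ≤ ‖a β • siteToE z'‖ →
              |(a β)⁻¹ ^ 8 * (torusE G r β L (fun U => plane G r p 0 U * plane G r q z U) -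
                  torusE G r β L (plane G r p 0) * torusE G r β L (plane G r q z)) -
                (a β)⁻¹ ^ 8 * (torusE G r β L (fun U => plane G r p 0 U * plane G r q z' U) -
                  torusE G r β L (plane G r p 0) * torusE G r β L (plane G r q z'))| ≤
                ω ‖a β • siteToE z - a β • siteToE z'‖) :
    ∀ η : ℝ, 0 < η → ∃ (C β₅ Λ₅ : ℝ) (ω : ℝ → ℝ), Tendsto ω (𝓝[>] 0) (𝓝 0) ∧
      ∀ β : ℝ, β₅ ≤ β → ∀ L : ℕ, Λ₅ ≤ a β * L → ∀ z ∈ box 4 L, η ≤ ‖a β • siteToE z‖ →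
        |(a β)⁻¹ ^ 8 * (torusE G r β L (fun U => dens G r 0 U * dens G r z U) -
            torusE G r β L (dens G r 0) * torusE G r β L (dens G r z))| ≤ C ∧
          ∀ z' ∈ box 4 L, η ≤ ‖a β • siteToE z'‖ →
            |(a β)⁻¹ ^ 8 * (torusE G r β L (fun U => dens G r 0 U * dens G r z U) -
                torusE G r β L (dens G r 0) * torusE G r β L (dens G r z)) -
              (a β)⁻¹ ^ 8 * (torusE G r β L (fun U => dens G r 0 U * dens G r z' U) -
                torusE G r β L (dens G r 0) * torusE G r β L (dens G r z'))| ≤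
              ω ‖a β • siteToE z - a β • siteToE z'‖ := by
  intro η hη
  choose C β₅ Λ₅ ω hω hmain using
    fun s : {q : Fin 4 × Fin 4 // q.1 < q.2} × {q : Fin 4 × Fin 4 // q.1 < q.2} =>
      hT6 s.1.1 s.2.1 s.1.2 s.2.2 η hη
  -- the full kernel is the sum of the plane kernels over the orientation pairs
  have hsplit : ∀ (β : ℝ) (L : ℕ) (z : Fin 4 → ℤ),
      (a β)⁻¹ ^ 8 * (torusE G r β L (fun U => dens G r 0 U * dens G r z U) -
          torusE G r β L (dens G r 0) * torusE G r β L (dens G r z)) =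
        ∑ s : {q : Fin 4 × Fin 4 // q.1 < q.2} × {q : Fin 4 × Fin 4 // q.1 < q.2},
          (a β)⁻¹ ^ 8 * (torusE G r β L (fun U => plane G r s.1.1 0 U * plane G r s.2.1 z U) -
            torusE G r β L (plane G r s.1.1 0) * torusE G r β L (plane G r s.2.1 z)) := by
    intro β L z
    rw [cov_dens_zero_eq_sum, Finset.mul_sum, Fintype.sum_prod_type]
    exact Finset.sum_congr rfl fun p _ => Finset.mul_sum _ _ _
  refine ⟨∑ s, C s, ∑ s, |β₅ s|, ∑ s, |Λ₅ s|, fun t => ∑ s, ω s t, ?_, ?_⟩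
  · simpa using tendsto_finsetSum (Finset.univ) (fun s _ => hω s)
  · intro β hβ L hL z hz hzη
    have hβs : ∀ s, β₅ s ≤ β := fun s =>
      (le_abs_self _).trans ((Finset.single_le_sum (fun s' _ => abs_nonneg (β₅ s')) (Finset.mem_univ s)).trans hβ)
    have hLs : ∀ s, Λ₅ s ≤ a β * L := fun s =>
      (le_abs_self _).trans ((Finset.single_le_sum (fun s' _ => abs_nonneg (Λ₅ s')) (Finset.mem_univ s)).trans hL)
    have hm := fun s => hmain s β (hβs s) L (hLs s) z hz hzη
    refine ⟨?_, fun z' hz' hz'η => ?_⟩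
    · rw [hsplit]
      exact (Finset.abs_sum_le_sum_abs _ _).trans (Finset.sum_le_sum fun s _ => (hm s).1)
    · rw [hsplit, hsplit, ← Finset.sum_sub_distrib]
      exact (Finset.abs_sum_le_sum_abs _ _).trans (Finset.sum_le_sum fun s _ => (hm s).2 z' hz' hz'η)

/-- **`PlaneLimitExtraction`** (route `UniversalDetector`, support item): extraction of a continuum limit kernel with
all its lattice-inherited properties, from the plane-resolved tightness (TIGHT6). -/
theorem planeLimitExtraction : Summit.QuantumFields.YangMills.Theses.UniversalDetector.PlaneLimitExtraction := by
  intro G _ _ _ _ hG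
  letI : MeasurableSpace G := borel G
  haveI : BorelSpace G := ⟨rfl⟩
  intro r a ha hlim
  dsimp only
  intro hT6 βs Ls hβ hL
  -- TIGHT6 ⇒ TIGHT, then the mesh Arzelà–Ascoli extraction (clauses 1–3)
  have hT := tight_of_tight6 r a hT6
  obtain ⟨φ, K, hφ, happ, hcont, hbd⟩ := latticeKernel_extraction_of_tight (d := 4) a
    (fun β L z => (a β)⁻¹ ^ 8 * (torusE G r β L (fun U => dens G r 0 U * dens G r z U) -
      torusE G r β L (dens G r 0) * torusE G r β L (dens G r z))) ha hlim hT βs Ls hβ hL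
  -- the sequences along the subsequence
  have hs : ∀ k, 0 < a (βs k) := fun k => ha _
  have hs0 : Tendsto (fun k => a (βs k)) atTop (𝓝 0) := hlim.comp hβ
  have hβ' : Tendsto (fun k => βs (φ k)) atTop atTop := hβ.comp hφ.tendsto_atTop
  have hL' : Tendsto (fun k => a (βs (φ k)) * (Ls (φ k) : ℝ)) atTop atTop := hL.comp hφ.tendsto_atTop
  have hs' : ∀ k, 0 < a (βs (φ k)) := fun k => ha _
  have hs0' : Tendsto (fun k => a (βs (φ k))) atTop (𝓝 0) := hlim.comp hβ'
  -- the generic symmetry transport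
  have transport := latticeLimit_invariant_approx (d := 4) (fun k => a (βs k)) Ls
    (fun k z => (a (βs k))⁻¹ ^ 8 * (torusE G r (βs k) (Ls k) (fun U => dens G r 0 U * dens G r z U) -
      torusE G r (βs k) (Ls k) (dens G r 0) * torusE G r (βs k) (Ls k) (dens G r z))) hs hs0 hL φ hφ K happ hcont
  -- far bound of the lattice kernels along the subsequence (from TIGHT)
  have farBound : ∀ t₀ : ℝ, 0 < t₀ → ∃ C : ℝ, ∀ᶠ k in atTop, ∀ z ∈ box 4 (Ls (φ k)),
      2 * t₀ ≤ ‖a (βs (φ k)) • siteToE z‖ →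
        |(a (βs (φ k)))⁻¹ ^ 8 * (torusE G r (βs (φ k)) (Ls (φ k)) (fun U => dens G r 0 U * dens G r z U) -
          torusE G r (βs (φ k)) (Ls (φ k)) (dens G r 0) * torusE G r (βs (φ k)) (Ls (φ k)) (dens G r z))| ≤ C := by
    intro t₀ ht₀
    obtain ⟨C, ω, k₀, -, h⟩ := seqTight_of_tight (d := 4) a
      (fun β L z => (a β)⁻¹ ^ 8 * (torusE G r β L (fun U => dens G r 0 U * dens G r z U) -
        torusE G r β L (dens G r 0) * torusE G r β L (dens G r z))) (fun k => βs (φ k)) (fun k => Ls (φ k))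
      hβ' hL' hT (2 * t₀) (by positivity)
    exact ⟨C, eventually_atTop.2 ⟨k₀, fun k hk z hz hzη => (h k hk z (Finset.mem_coe.2 hz) hzη).1⟩⟩
  refine ⟨φ, K, hφ, happ, hcont, hbd, ?_, ?_, ?_, ?_, ?_⟩
  · -- (4) evenness, from translation invariance on the torus
    intro z
    by_cases hz : z = 0
    · simp [hz]
    refine transport (fun _ z => -z) (fun v => -v) (Eventually.of_forall fun k z hz' =>
        ⟨neg_mem_box' hz', siteToE_neg' _ _⟩) (fun η ε hη hε => Eventually.of_forall fun k z _ _ _ => ?_)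
      z hz (neg_ne_zero.2 hz) continuous_neg.continuousAt
    rw [cov_dens_zero_neg, sub_self, abs_zero]
    exact hε.le
  · -- (5) time-reflection invariance, from the vanishing reflection defect under (TIGHT6)
    intro z
    by_cases hz : z = 0
    · simp [hz]
    refine transport (fun _ z => siteReflect z) (timeReflection 4) (Eventually.of_forall fun k z hz' =>
        ⟨siteReflect_mem_box hz', (timeReflection_smul_siteToE _ _).symm⟩)
      (reflect_defect_eventually r a ha hlim hT6 (fun k => βs (φ k)) (fun k => Ls (φ k)) hβ' hL')
      z hz (fun h => hz ((timeReflection 4).injective (h.trans (map_zero _).symm)))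
      (timeReflection 4).continuous.continuousAt
  · -- (6) coordinate-permutation invariance, from the hypercubic symmetry of the torus
    intro σ z
    by_cases hz : z = 0
    · subst hz
      congr 1
    have h := transport (fun _ z => fun i => z (σ i)) (LinearIsometryEquiv.piLpCongrLeft 2 ℝ ℝ σ.symm)
      (Eventually.of_forall fun k z hz' => ⟨perm_mem_box' hz' σ, siteToE_perm' _ _ σ⟩)
      (fun η ε hη hε => Eventually.of_forall fun k z _ _ _ => by
        rw [cov_dens_zero_perm, sub_self, abs_zero]
        exact hε.le)
      z hz (fun h => hz ((LinearIsometryEquiv.piLpCongrLeft 2 ℝ ℝ σ.symm).injective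
        (h.trans (map_zero _).symm)))
      (LinearIsometryEquiv.piLpCongrLeft 2 ℝ ℝ σ.symm).continuous.continuousAt
    rwa [piLpCongrLeft_symm_eq_toLp'] at h
  · -- (7) reflection positivity on time slabs
    intro w t₀ T ht₀ hw
    have hθ := tsupport_thetaTest_subset_slab w hw
    obtain ⟨CK, hCK⟩ := hbd (2 * t₀) (by positivity)
    obtain ⟨C, hTb⟩ := farBound t₀ ht₀
    have hM := Q2_farBound_of_tight r (thetaTest 4 w) w K ht₀ hθ hw hCK (fun k => βs (φ k))
      (fun k => Ls (φ k)) (fun k => a (βs (φ k))) hs' hL' hTb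
    have hnear := Q2_nearKernel_of_approx r (thetaTest 4 w) w K ht₀ hθ hw (fun k => βs (φ k))
      (fun k => Ls (φ k)) (fun k => a (βs (φ k))) hs' hL' happ
    obtain ⟨δ, hδ, hpos⟩ := Q2_thetaTest_eventually_ge_neg r a ha hlim hT6 (fun k => βs (φ k))
      (fun k => Ls (φ k)) hβ' hL' w ht₀ hw
    exact integral_nonneg_of_Q2_ge_neg r (thetaTest 4 w) w K t₀ ht₀ (fun y hy => (hθ hy).1)
      (fun y hy => (hw hy).1) hcont hbd (fun k => βs (φ k)) (fun k => Ls (φ k)) (fun k => a (βs (φ k)))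
      hs' hs0' hL' (C + CK) hM hnear δ hδ hpos
  · -- (8) the limits of the Schwartz-weighted Riemann sums
    intro w₁ w₂ t₀ T ht₀ h₁ h₂
    obtain ⟨CK, hCK⟩ := hbd (2 * t₀) (by positivity)
    obtain ⟨C, hTb⟩ := farBound t₀ ht₀
    have hM := Q2_farBound_of_tight r w₁ w₂ K ht₀ h₁ h₂ hCK (fun k => βs (φ k))
      (fun k => Ls (φ k)) (fun k => a (βs (φ k))) hs' hL' hTb
    have hnear := Q2_nearKernel_of_approx r w₁ w₂ K ht₀ h₁ h₂ (fun k => βs (φ k))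
      (fun k => Ls (φ k)) (fun k => a (βs (φ k))) hs' hL' happ
    exact tendsto_Q2_of_near_kernel G r w₁ w₂ K t₀ ht₀ (fun y hy => (h₁ hy).1) (fun y hy => (h₂ hy).1)
      hcont hbd (fun k => βs (φ k)) (fun k => Ls (φ k)) (fun k => a (βs (φ k))) hs' hs0' hL' (C + CK) hM hnear

end Summit.QuantumFields.YangMills.Cruxes.UniversalDetectorPlaneTight

end
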